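import Summits.BirchSwinnertonDyer.BirchSwinnertonDyer.Theses.SylvesterTwoHeegnerIndex
import Summits.BirchSwinnertonDyer.BirchSwinnertonDyer.Theorems.SylvesterTwoHeegnerIndexHSYPointLower

/-! # Skeleton PROPOSAL (k7t-c2 g9, 2026-08-27) for K7t item 19892 `LowerOffV0HSY` — VARIANT P «HSY point currency,
PRINT-ONLY inputs» (residue split kept, as in the skeleton of record). NOT registered by this seat (planner's pen).
Stubs: (H) Hu–Shu–Yin's PRINTED display (tree named fact `HuShuYin2019.shaAnPair_mul_height_eq_two_zpow_mul_height`,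
item 19726 — displayed like (F⁺), never a prover target) + (lowP-off-4) / (lowP-off-7) = the registered pair-currency stubs
RE-TYPED as point-divisibility bounds on Hu–Shu–Yin's Heegner point `Y` (kernel certificate of equivalence modulo (H):
`SylvesterTwoYinLower.lowerOffV0HSY_iff_pointBoundOffV0`, k7t-c2 g9 `…HSYPointLower.lean`). Composition = `.mpr` of that iff + `h9.elim`.
Sorries only in the three stubs. -/

set_option autoImplicit false
set_option linter.dupNamespace false

noncomputable section

open scoped Classical
open WeierstrassCurve WeierstrassCurve.Affine WeierstrassCurve.Affine.Point
  Literature.NumberTheory.EllipticCurves Literature.NumberTheory.EllipticCurves.HuShuYin2019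
  Summit.BirchSwinnertonDyer.BirchSwinnertonDyer.Theses.SylvesterTwoHeegnerIndex
  Summit.BirchSwinnertonDyer.BirchSwinnertonDyer.Theorems

namespace Summit.BirchSwinnertonDyer.BirchSwinnertonDyer.Cruxes.LowerOffV0HSY.HSYPoint

/-- (H) Hu–Shu–Yin 2019 display (bsd) p. 12 + Cor. 4.4: PRINTED named fact (item 19726; conjunct of
`PublishedFactsTwoPlus`); displayed input — never a prover target. -/
theorem stub_hsyHeightDisplay : shaAnPair_mul_height_eq_two_zpow_mul_height := by
  sorry

/-- (lowP-off-4) `p ≡ 4 (mod 9)` (`i = 0`): at every HSY display datum of every off-`𝒱₀` pair, `2^j ∣ Y (mod tors) ⟹ 2j ≤ s_B + s_A` (extra 2-divisibility of the explicit Heegner point FORCES Ш of the pair). Main-conjecture direction at the inert prime `2`;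
OPEN as a class; research stub. -/
theorem stub_hsyPointBound_fourModNine :
    PublishedFactsTwo → ∀ (p : ℕ), p.Prime → p % 9 = 4 →
        (¬ ∃ x : ZMod p, x ^ 3 = 3) →
        ∀ (A B : WeierstrassCurve ℚ) [A.IsElliptic] [A.IsGloballyMinimal] [B.IsElliptic]
          [B.IsGloballyMinimal], (∃ C : VariableChange ℚ, C • B = cubeSumCurve (p : ℚ)) →
          (∃ C : VariableChange ℚ, C • A = cubeSumCurve (3 * (p : ℚ) ^ 2)) →
          ¬ (Nat.card (AddCommGroup.primaryComponent B.sha 2) = 1 ∧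
            Nat.card (AddCommGroup.primaryComponent A.sha 2) = 1) →
          ∀ (qB qA : ℚ), shaAn B = (qB : ℂ) → shaAn A = (qA : ℂ) →
          ∀ (K : Type) [Field K] [NumberField K] (ω : K), ω ^ 2 + ω + 1 = 0 → Module.finrank ℚ K = 2 →
          ∀ (P₀ : B.toAffine.Point), ¬ IsOfFinAddOrder (QuadraticDescent.incl K B P₀) →
            (∀ Q : B.toAffine.Point, ∃ m : ℤ,
              IsOfFinAddOrder (QuadraticDescent.incl K B Q - m • QuadraticDescent.incl K B P₀)) →
          ∀ (Y : (B.baseChange K).toAffine.Point),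
            ((qB * qA : ℚ) : ℝ) * canonicalHeight (QuadraticDescent.incl K B P₀) =
              (2 : ℝ) ^ (if p % 9 = 4 then (0 : ℤ) else -2) * canonicalHeight Y →
          ∀ j : ℕ, (∃ Y' T' : (B.baseChange K).toAffine.Point,
              IsOfFinAddOrder T' ∧ Y = ((2 : ℤ) ^ j) • Y' + T') →
            (if p % 9 = 4 then (0 : ℤ) else -2) + 2 * (j : ℤ) ≤ 
              (padicValNat 2 (Nat.card (AddCommGroup.primaryComponent B.sha 2)) : ℤ) +
                (padicValNat 2 (Nat.card (AddCommGroup.primaryComponent A.sha 2)) : ℤ) := by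
  sorry

/-- (lowP-off-7) `p ≡ 7 (mod 9)` (`i = −2`): same, `2^j ∣ Y ⟹ 2j − 2 ≤ s_B + s_A` (one factor `2` is that of THEOREM C). Research stub. -/
theorem stub_hsyPointBound_sevenModNine :
    PublishedFactsTwo → ∀ (p : ℕ), p.Prime → p % 9 = 7 →
        (¬ ∃ x : ZMod p, x ^ 3 = 3) →
        ∀ (A B : WeierstrassCurve ℚ) [A.IsElliptic] [A.IsGloballyMinimal] [B.IsElliptic]
          [B.IsGloballyMinimal], (∃ C : VariableChange ℚ, C • B = cubeSumCurve (p : ℚ)) →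
          (∃ C : VariableChange ℚ, C • A = cubeSumCurve (3 * (p : ℚ) ^ 2)) →
          ¬ (Nat.card (AddCommGroup.primaryComponent B.sha 2) = 1 ∧
            Nat.card (AddCommGroup.primaryComponent A.sha 2) = 1) →
          ∀ (qB qA : ℚ), shaAn B = (qB : ℂ) → shaAn A = (qA : ℂ) →
          ∀ (K : Type) [Field K] [NumberField K] (ω : K), ω ^ 2 + ω + 1 = 0 → Module.finrank ℚ K = 2 →
          ∀ (P₀ : B.toAffine.Point), ¬ IsOfFinAddOrder (QuadraticDescent.incl K B P₀) →
            (∀ Q : B.toAffine.Point, ∃ m : ℤ,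
              IsOfFinAddOrder (QuadraticDescent.incl K B Q - m • QuadraticDescent.incl K B P₀)) →
          ∀ (Y : (B.baseChange K).toAffine.Point),
            ((qB * qA : ℚ) : ℝ) * canonicalHeight (QuadraticDescent.incl K B P₀) =
              (2 : ℝ) ^ (if p % 9 = 4 then (0 : ℤ) else -2) * canonicalHeight Y →
          ∀ j : ℕ, (∃ Y' T' : (B.baseChange K).toAffine.Point,
              IsOfFinAddOrder T' ∧ Y = ((2 : ℤ) ^ j) • Y' + T') →
            (if p % 9 = 4 then (0 : ℤ) else -2) + 2 * (j : ℤ) ≤ 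
              (padicValNat 2 (Nat.card (AddCommGroup.primaryComponent B.sha 2)) : ℤ) +
                (padicValNat 2 (Nat.card (AddCommGroup.primaryComponent A.sha 2)) : ℤ) := by
  sorry

/-- composition: the crux `LowerOffV0HSY` BY NAME from (H) + (lowP-off-4) + (lowP-off-7) through k7t-c2 g9's
`SylvesterTwoYinLower.lowerOffV0HSY_iff_pointBoundOffV0` (`.mpr`) and the residue case split. -/
theorem LowerOffV0HSY_of :
    Summit.BirchSwinnertonDyer.BirchSwinnertonDyer.Theses.SylvesterTwoHeegnerIndex.LowerOffV0HSY :=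
  (SylvesterTwoYinLower.lowerOffV0HSY_iff_pointBoundOffV0 stub_hsyHeightDisplay).mpr
    (fun hF p hp h9 h3 A B _ _ _ _ hB hA hV =>
      h9.elim (fun h4 => stub_hsyPointBound_fourModNine hF p hp h4 h3 A B hB hA hV)
        (fun h7 => stub_hsyPointBound_sevenModNine hF p hp h7 h3 A B hB hA hV))

end Summit.BirchSwinnertonDyer.BirchSwinnertonDyer.Cruxes.LowerOffV0HSY.HSYPoint

end
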